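/-
COR-CM (cell pub-hodgecm2, stage 2 of the Hodge ladder) — Δ2 BRIDGE, VERSION-B item (c) J-RECORD PIN, the J2 ⇄ J-record GLUE:
prove-2's interface `ComponentAlbanese` (`CorCM/D2Bridge/ComponentAlbanese.lean`) INHABITED by the J2 pin «ALBANESE ON COMPONENTS»:
Liu's Albanese morphism `(α_K)_x` ([Liu2021] proof of Lemma 2.4 (1), §4.2 (4.1)) restricted to the components
`componentInj K h : P_{Γ_K.conj h}(V) ⟶ X_K ⊗_{ῑ₁} ℂ` of `ShimuraComponentInj.lean` ([Deligne 1979, 2.1.2] `[z] ↦ [z, hK]`), i.e.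
`albOnPiece (C.alb K) (componentInj K h) (basePt K h)` (core `AlbaneseOnPieceCore.lean`), at Liu's explicit §4.2 carrier
`Model.sec42DataOfFourLe` with its Hecke translates, then transported to the TOTAL carrier `Model.sec42DataOf`.
Seat prover-pub-hodgecm2-d2bridge-prove-5-g0-0.  Theorems only (no definition, no `sorry`, no new axiom); the cited named facts
`exists_recordSystem`, `heckeTranslate_definedOver`, `exists_isReal_hodgeModel`, `hodgePQ_independent_of_hodgeModel`,
`Arapura2012_Cor_15_4_6` and the standing carriers `hU ∕ h₃` are explicit binders.  FRAMING: HC_CM is NOT proved; «Δ2 BRIDGE CLOSED» is NOT claimed.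
-/
import Summits.HodgeConjecture.CorCM.D2Bridge.ShimuraComponentInj
import Summits.HodgeConjecture.CorCM.D2Bridge.AlbaneseOnPieceFunctorial
import Summits.HodgeConjecture.CorCM.D2Bridge.AlbaneseOnPieceDetects
import Summits.HodgeConjecture.CorCM.D2Bridge.ComponentAlbanese
import Summits.HodgeConjecture.CorCM.D2Bridge.HcmS3AlbaneseBetti
import HarnessLib

/-!
# Δ2 bridge, J-record pin: `ComponentAlbanese` INHABITED at the pin

For the model's tower over `(L, ι₁, V)` (`4 ≤ [L:ℚ]`), Liu's §4.2 datum `C := Model.sec42DataOfFourLe h ⟨V.Hm,…⟩ Φ h4 iso` over the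
honest Prop.-C.5 system (levels `K ⊆ K_f(3)`, `X_K = M_K ⊗_{L,c} L`, `A_K = Alb_{X_K}`, transitions `C.Atr`) and its Hecke translates
`T := Model.sec42DataOfFourLe_heckeTranslates hU7 h …`:

* `pull_albOnPiece_componentInj_rel ∕ _Atr ∕ _albTr` — LAWS (ii) (tower relation `Rel`), (iii) (level transitions `Alb(u)`),
  (iv) (Hecke translates `Alb(T_g)`) ON `H¹`, for `alb K h := albOnPiece (C.alb K) (componentInj K h) (basePt K h)`: the component laws
  `componentInj_rel ∕ _comp_map ∕ _comp_tr` (ON THE NOSE, part A) fed to the core's functoriality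
  `pull_albOnPiece_reparam ∕ _comp_baseChange_Atr ∕ _comp_baseChange_albTr`.
* `exists_pull_albOnPiece_componentInj_ne_zero` — LAW (v′), detection of non-zero `E`-homomorphisms `φ : A_K → B` on `H¹` by some
  component (prove-3's `exists_pull_albOnPiece_baseChange_ne_zero'` on the cofan `exists_isColimit_componentInj`; [Liu2021] Lemma 2.4 (1)
  per piece = S3 `bijective_pull_abelJacobi_pms`).
* `nonempty_componentAlbanesePin` — **the interface `ComponentAlbanese hHD hI hU h₃ hA V h Φ C T` is inhabited** (`Γof K := levelOf V K`).
* `nonempty_componentAlbanesePinTotal` — the same at the TOTAL carrier `Model.sec42DataOf h iso …` ∕ `Model.sec42DataOf_heckeTranslates`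
  (`ComponentAlbanese.transport` along `Model.sec42DataOf_eq_of_four_le`, a `dif_pos`).

HC_CM is NOT proved; nothing here is a display or a pointer move.
-/

set_option autoImplicit false

noncomputable section

open Function CategoryTheory CategoryTheory.Limits AlgebraicGeometry NumberField
open Literature.AlgebraicGeometry.Motives
open Literature.AlgebraicGeometry.HodgeTheory
open Literature.AlgebraicGeometry.ShimuraVarieties
open Literature.AlgebraicGeometry.ShimuraVarieties.UnitaryCanonicalModel
open Literature.NumberTheory.Automorphic Literature.NumberTheory.Automorphic.PicardCM
open Literature.NumberTheory.Automorphic.Liu2021 Literature.NumberTheory.Automorphic.Liu2021.AppendixC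
open Literature.NumberTheory.Transcendental (Arapura2012_Cor_15_4_6)
open Summit.HodgeConjecture.CorCM.Model Summit.HodgeConjecture.CorCM.HComp
open HodgeCM.Model HodgeCM.Model.LevelTranslate HodgeCM.Model.TowerLevel

namespace Summit.HodgeConjecture.CorCM.D2Bridge

open AbelianVariety (bcFunctor)

variable {L : HodgeCM.CMField} {ι₁ : L →+* ℂ}

/-! ## §1 LAWS (ii)–(iv) on `H¹` for `albOnPiece (C.alb K) (componentInj K h) (basePt K h)` -/

/-- **LAW (ii) on `Hⁱ` — the tower relation**: for `Rel Γ_K γ h h'`,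
`((α_K)|_{P_h})^* = t_γ^* ∘ ((α_K)|_{P_{h'}})^*` on `Hⁱ((A_K ⊗ ℂ)(ℂ); ℚ)` (`componentInj_rel`: both indices name the SAME component,
identified by `z ↦ γz`; the core's re-parametrisation law). [cite: Liu2021, proof of Lemma 2.4 (1) (l. 1220–1228)] [cite: Deligne1979ShimuraVarieties, §2.1.2] -/
theorem pull_albOnPiece_componentInj_rel (V : HodgeCM.HermSpace3 L ι₁) (hU : BallQuotientUniformisedDatum)
    (h₃ : CMAbelianVarietyRealised) (h4 : 4 ≤ Module.finrank ℚ L) (h : exists_recordSystem) (hHD : exists_isReal_hodgeModel)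
    [Algebra L ℂ] (hι : (algebraMap L ℂ).comp (cmConjRingHom L) = ι₁) (hA : Arapura2012_Cor_15_4_6) (Φ : CMType (pkgF L))
    (iso : ℕ → Prop) (K : C5.SmallLevel (K3 (pkgV V))) {hh hh' : V.adelicFin} {γ : ↥(Urat V)} (r : Rel (levelOf V K) γ hh hh')
    (i : ℕ) :
    haveI := geometricallyIrreducible_pms hU h₃ (code V K hh)
    haveI := geometricallyIrreducible_pms hU h₃ (code V K hh')
    BettiUniverse.pull (albOnPiece ((sec42DataOfFourLe h (pkgV V) Φ h4 iso).alb K) (componentInj V hU h₃ h4 h hHD hι K hh)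
        (basePt V hU h₃ K hh)) i =
      BettiUniverse.pull (transMor hU h₃ hHD hA γ.2 ((levelOf V K).conj hh (belowConjThree_levelOf V K))
          ((levelOf V K).conj hh' (belowConjThree_levelOf V K)) (transCond_of_rel (belowConjThree_levelOf V K) r)) i ∘ₗ
        BettiUniverse.pull (albOnPiece ((sec42DataOfFourLe h (pkgV V) Φ h4 iso).alb K) (componentInj V hU h₃ h4 h hHD hι K hh')
          (basePt V hU h₃ K hh')) i :=
  pull_albOnPiece_reparam ((sec42DataOfFourLe h (pkgV V) Φ h4 iso).alb K) (componentInj V hU h₃ h4 h hHD hι K hh')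
    (componentInj V hU h₃ h4 h hHD hι K hh) _ (isSmoothProjective_P V hU h₃ K hh') (isSmoothProjective_P V hU h₃ K hh)
    (componentInj_rel V hU h₃ h4 h hHD hι hA K r).symm _ _ i

/-- **LAW (iii) on `Hⁱ` — level transitions**: for `K' ⊆ K` (`f : K' ⟶ K`) and Liu's `Alb(u^{K'}_K) = C.Atr f : A_{K'} → A_K`:
`((α_{K'})|_{P'_h})^* ∘ (Alb u)_ℂ^* = t_1^* ∘ ((α_K)|_{P_h})^*` (`componentInj_comp_map` fed to the core's transition square).
[cite: Liu2021, §4.2 l. 2062–2074 and Def. 2.3 (l. 1207)] -/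
theorem pull_albOnPiece_componentInj_Atr (V : HodgeCM.HermSpace3 L ι₁) (hU : BallQuotientUniformisedDatum)
    (h₃ : CMAbelianVarietyRealised) (h4 : 4 ≤ Module.finrank ℚ L) (h : exists_recordSystem) (hHD : exists_isReal_hodgeModel)
    [Algebra L ℂ] (hι : (algebraMap L ℂ).comp (cmConjRingHom L) = ι₁) (hA : Arapura2012_Cor_15_4_6) (Φ : CMType (pkgF L))
    (iso : ℕ → Prop) {K K' : C5.SmallLevel (K3 (pkgV V))} (f : K' ⟶ K) (hh : V.adelicFin) (i : ℕ) :
    haveI := geometricallyIrreducible_pms hU h₃ (code V K hh)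
    haveI := geometricallyIrreducible_pms hU h₃ (code V K' hh)
    BettiUniverse.pull (albOnPiece ((sec42DataOfFourLe h (pkgV V) Φ h4 iso).alb K') (componentInj V hU h₃ h4 h hHD hι K' hh)
          (basePt V hU h₃ K' hh)) i ∘ₗ
        BettiUniverse.pull (AbelianVariety.Hom.baseChange ℂ ((sec42DataOfFourLe h (pkgV V) Φ h4 iso).Atr f)).hom.hom.hom i =
      BettiUniverse.pull (transMor hU h₃ hHD hA (Subgroup.one_mem (Urat V)) ((levelOf V K').conj hh (belowConjThree_levelOf V K'))
          ((levelOf V K).conj hh (belowConjThree_levelOf V K))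
          (transCond_conj_of_le (levelOf_mono V f.le) (belowConjThree_levelOf V K) (belowConjThree_levelOf V K') hh)) i ∘ₗ
        BettiUniverse.pull (albOnPiece ((sec42DataOfFourLe h (pkgV V) Φ h4 iso).alb K) (componentInj V hU h₃ h4 h hHD hι K hh)
          (basePt V hU h₃ K hh)) i :=
  pull_albOnPiece_comp_baseChange_Atr (sec42DataOfFourLe h (pkgV V) Φ h4 iso) (componentInj V hU h₃ h4 h hHD hι K hh)
    (componentInj V hU h₃ h4 h hHD hι K' hh) _ (isSmoothProjective_P V hU h₃ K hh) (isSmoothProjective_P V hU h₃ K' hh) f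
    (componentInj_comp_map V hU h₃ h4 h hHD hι hA Φ f hh).symm _ _ i

/-- **LAW (iv) on `Hⁱ` — Hecke translates**: for `g⁻¹K₁g ⊆ K` and Liu's `Alb(T_g) = T.albTr g K₁ K : A_{K₁} → A_K` of the translates
`T := Model.sec42DataOfFourLe_heckeTranslates hU7 h …` (§4.2 l. 2074 «the Hecke correspondences provide a homomorphism
`𝔾(𝔸_F^∞) → Aut_E(A_∞)`»): `((α_{K₁})|_{P_h})^* ∘ (Alb T_g)_ℂ^* = t_1^* ∘ ((α_K)|_{P_{hg}})^*` (`componentInj_comp_tr` fed to the core's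
Hecke square). [cite: Liu2021, §4.2 l. 2070–2074] [cite: Milne2005ShimuraVarieties, §13 p. 118 L21–26 and Thm. 13.6] -/
theorem pull_albOnPiece_componentInj_albTr (V : HodgeCM.HermSpace3 L ι₁) (hU : BallQuotientUniformisedDatum)
    (h₃ : CMAbelianVarietyRealised) (h4 : 4 ≤ Module.finrank ℚ L) (h : exists_recordSystem) (hHD : exists_isReal_hodgeModel)
    [Algebra L ℂ] (hι : (algebraMap L ℂ).comp (cmConjRingHom L) = ι₁) (hA : Arapura2012_Cor_15_4_6)
    (hU7 : heckeTranslate_definedOver) (Φ : CMType (pkgF L)) (iso : ℕ → Prop) {K₁ K : C5.SmallLevel (K3 (pkgV V))}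
    (g : V.adelicFin) (hle : C5.HeckeLE g K₁ K) (hh : V.adelicFin) (i : ℕ) :
    haveI := geometricallyIrreducible_pms hU h₃ (code V K₁ hh)
    haveI := geometricallyIrreducible_pms hU h₃ (code V K (hh * g))
    BettiUniverse.pull (albOnPiece ((sec42DataOfFourLe h (pkgV V) Φ h4 iso).alb K₁) (componentInj V hU h₃ h4 h hHD hι K₁ hh)
          (basePt V hU h₃ K₁ hh)) i ∘ₗ
        BettiUniverse.pull (AbelianVariety.Hom.baseChange ℂ
          ((sec42DataOfFourLe_heckeTranslates hU7 h (pkgV V) Φ h4 iso).albTr g K₁ K hle)).hom.hom.hom i =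
      BettiUniverse.pull (transMor hU h₃ hHD hA (Subgroup.one_mem (Urat V)) ((levelOf V K₁).conj hh (belowConjThree_levelOf V K₁))
          ((levelOf V K).conj (hh * g) (belowConjThree_levelOf V K)) (transCond_conj_mul_of_heckeLE V hle hh)) i ∘ₗ
        BettiUniverse.pull (albOnPiece ((sec42DataOfFourLe h (pkgV V) Φ h4 iso).alb K) (componentInj V hU h₃ h4 h hHD hι K (hh * g))
          (basePt V hU h₃ K (hh * g))) i :=
  pull_albOnPiece_comp_baseChange_albTr (sec42DataOfFourLe h (pkgV V) Φ h4 iso) (componentInj V hU h₃ h4 h hHD hι K₁ hh)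
    (componentInj V hU h₃ h4 h hHD hι K (hh * g)) (isSmoothProjective_P V hU h₃ K₁ hh) (isSmoothProjective_P V hU h₃ K (hh * g))
    (sec42DataOfFourLe_heckeTranslates hU7 h (pkgV V) Φ h4 iso) g hle _
    (componentInj_comp_tr V hU h₃ h4 h hHD hι hA hU7 Φ iso g hle hh).symm _ _ i

/-! ## §2 LAW (v′): detection on `H¹` -/

/-- **LAW (v′) — detection**: a non-zero `E`-homomorphism `φ : A_K → B` has a component `h` with
`((α_K)|_{P_{Γ_K.conj h}} ≫ φ_ℂ)^* ≠ 0` on `H¹(B(ℂ); ℚ)` ([Liu2021] proof of Thm. 4.18, l. 2248–2250 «by pulling back … we obtain an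
injective map»; Lemma 2.4 (1) per piece).  Prove-3's `exists_pull_albOnPiece_baseChange_ne_zero'` (cover of `(∇X_K)_ℂ` by the
`P × P`, faithfulness of `H¹`) on the coproduct cofan of components `exists_isColimit_componentInj`, `(f^P)^*` injective by S3
`bijective_pull_abelJacobi_pms`. [cite: Liu2021, proof of Thm. 4.18 (FJcycle.tex l. 2248–2250) and Lemma 2.4 (1) (l. 1213, proof l. 1220–1228)] -/
theorem exists_pull_albOnPiece_componentInj_ne_zero (V : HodgeCM.HermSpace3 L ι₁) (hU : BallQuotientUniformisedDatum)
    (h₃ : CMAbelianVarietyRealised) (h4 : 4 ≤ Module.finrank ℚ L) (h : exists_recordSystem) (hHD : exists_isReal_hodgeModel)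
    [Algebra L ℂ] (hι : (algebraMap L ℂ).comp (cmConjRingHom L) = ι₁) (Φ : CMType (pkgF L)) (iso : ℕ → Prop)
    (K : C5.SmallLevel (K3 (pkgV V))) {B : AbelianVariety (pkgF L)} (φ : (sec42DataOfFourLe h (pkgV V) Φ h4 iso).A K ⟶ B)
    (hφ : φ ≠ 0) :
    ∃ hh : V.adelicFin,
      haveI := geometricallyIrreducible_pms hU h₃ (code V K hh)
      BettiUniverse.pull (albOnPiece ((sec42DataOfFourLe h (pkgV V) Φ h4 iso).alb K) (componentInj V hU h₃ h4 h hHD hι K hh)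
          (basePt V hU h₃ K hh) ≫ (AbelianVariety.Hom.baseChange ℂ φ).hom.hom.hom) 1 ≠ 0 := by
  classical
  obtain ⟨Ξ, _, g, ⟨hcol⟩⟩ := exists_isColimit_componentInj V hU h₃ h4 h hHD hι K
  haveI : ∀ q, GeometricallyIrreducible (P V hU h₃ K (g q)).hom := fun q => geometricallyIrreducible_pms hU h₃ _
  haveI := (compactifiedOf h (pkgV V) Φ h4).smooth_X K
  have h𝒥 : ∀ q, Nonempty (Jacobian (P V hU h₃ K (g q))) := fun q =>
    nonempty_jacobian_of_isSmoothProjective_complex_of_dim _ (isSmoothProjective_P V hU h₃ K (g q))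
  obtain ⟨q, hq⟩ := exists_pull_albOnPiece_baseChange_ne_zero' (d := (honestP5Of h (pkgF L) ι₁ (pkgV V) Φ).n - 1)
    (X := (compactifiedOf h (pkgV V) Φ h4).X.obj K) ((compactifiedOf h (pkgV V) Φ h4).projective_X K)
    ((sec42DataOfFourLe h (pkgV V) Φ h4 iso).alb K) (fun q => componentInj V hU h₃ h4 h hHD hι K (g q)) hcol
    (fun q => (h𝒥 q).some) (fun q => basePt V hU h₃ K (g q))
    (fun q => (bijective_pull_abelJacobi_pms (code V K (g q))
      (isAnisotropic_of_four_le V h4 ((levelOf V K).conj (g q) (belowConjThree_levelOf V K))) (h𝒥 q).some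
      (basePt V hU h₃ K (g q))).1) φ hφ
  exact ⟨g q, hq⟩

/-! ## §3 The interface, inhabited -/

/-- **The J2 interface of the J-record pin, INHABITED** at Liu's explicit §4.2 carrier over the honest datum and its Hecke translates:
`Γof K := levelOf V K` (`(U(L⁺) ∩ K, K)`), `alb K h := albOnPiece (C.alb K) (componentInj K h) (basePt K h)`, the laws (ii)–(iv), (v′)
of §1–§2 (`U.pull (transMorU …) = BettiUniverse.pull (transMor …)`, `Model.universeOf_pull`).
[cite: Liu2021, proof of Lemma 2.4 (1) (FJcycle.tex l. 1220–1228); §4.2 l. 2062–2074] [cite: Deligne1979ShimuraVarieties, §2.1.2] -/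
theorem nonempty_componentAlbanesePin (hHD : exists_isReal_hodgeModel) (hI : hodgePQ_independent_of_hodgeModel)
    (hU : BallQuotientUniformisedDatum) (h₃ : CMAbelianVarietyRealised) (hA : Arapura2012_Cor_15_4_6)
    (hU7 : heckeTranslate_definedOver) (V : HodgeCM.HermSpace3 L ι₁) (h : exists_recordSystem) (h4 : 4 ≤ Module.finrank ℚ L)
    [Algebra L ℂ] (hι : (algebraMap L ℂ).comp (cmConjRingHom L) = ι₁) (Φ : CMType (pkgF L)) (iso : ℕ → Prop) :
    Nonempty (ComponentAlbanese hHD hI hU h₃ hA V h Φ (sec42DataOfFourLe h (pkgV V) Φ h4 iso)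
      (sec42DataOfFourLe_heckeTranslates hU7 h (pkgV V) Φ h4 iso)) :=
  ⟨{ Γof := levelOf V
     belowConjThree := belowConjThree_levelOf V
     Γof_mono := fun hle => levelOf_mono V hle
     Γof_hecke := fun _ _ _ hle => levelOf_le_conj_of_heckeLE V hle
     alb := fun K hh =>
       haveI := geometricallyIrreducible_pms hU h₃ (code V K hh)
       albOnPiece ((sec42DataOfFourLe h (pkgV V) Φ h4 iso).alb K) (componentInj V hU h₃ h4 h hHD hι K hh) (basePt V hU h₃ K hh)
     pull_alb_rel := fun K _ _ _ r => by
       rw [HodgeCM.Model.universeOf_pull]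
       exact pull_albOnPiece_componentInj_rel V hU h₃ h4 h hHD hι hA Φ iso K r 1
     pull_alb_Atr := fun f hh => by
       rw [HodgeCM.Model.universeOf_pull]
       exact pull_albOnPiece_componentInj_Atr V hU h₃ h4 h hHD hι hA Φ iso f hh 1
     pull_alb_albTr := fun g _ _ hK hh => by
       rw [HodgeCM.Model.universeOf_pull]
       exact pull_albOnPiece_componentInj_albTr V hU h₃ h4 h hHD hι hA hU7 Φ iso g hK hh 1
     alb_detect := fun K _ φ hφ =>
       exists_pull_albOnPiece_componentInj_ne_zero V hU h₃ h4 h hHD hι Φ iso K φ hφ }⟩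

/-- **The J2 interface at the TOTAL carrier `C := Model.sec42DataOf h iso` of the END displays**, `T := Model.sec42DataOf_heckeTranslates`
(which is DEFINED as the cast of the explicit translates along `Model.sec42DataOf_eq_of_four_le`): `ComponentAlbanese.transport`.
[cite: Liu2021, §4.2 l. 2053–2074] -/
theorem nonempty_componentAlbanesePinTotal (hHD : exists_isReal_hodgeModel) (hI : hodgePQ_independent_of_hodgeModel)
    (hU : BallQuotientUniformisedDatum) (h₃ : CMAbelianVarietyRealised) (hA : Arapura2012_Cor_15_4_6)
    (hU7 : heckeTranslate_definedOver) (V : HodgeCM.HermSpace3 L ι₁) (h : exists_recordSystem) (h4 : 4 ≤ Module.finrank ℚ L)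
    [Algebra L ℂ] (hι : (algebraMap L ℂ).comp (cmConjRingHom L) = ι₁) (Φ : CMType (pkgF L))
    (iso : ∀ (F : Summit.HodgeConjecture.CorCM.CMField) (ι : F →+* ℂ) (_ : Summit.HodgeConjecture.CorCM.HermSpace3 F ι)
      (_ : CMType F), ℕ → Prop) :
    Nonempty (ComponentAlbanese hHD hI hU h₃ hA V h Φ (sec42DataOf h iso (pkgF L) ι₁ (pkgV V) Φ)
      (sec42DataOf_heckeTranslates hU7 h (pkgV V) Φ iso h4)) :=
  ⟨(Classical.choice (nonempty_componentAlbanesePin hHD hI hU h₃ hA hU7 V h h4 hι Φ (iso (pkgF L) ι₁ (pkgV V) Φ))).transport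
    (sec42DataOf_eq_of_four_le h (pkgV V) Φ iso h4).symm⟩

end Summit.HodgeConjecture.CorCM.D2Bridge

end
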